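import Mathlib
import Literature.Analysis.ODE.OrdinaryPointSeries
import Literature.Analysis.ODE.RationalTaylorMajorant
import HarnessLib

/-!
# Kernel-checkable analytic continuation of linear second-order ODEs, I: exact jets

Topic `Literature/Computation/Certificates` (namespace `Literature.Computation.Certificates.LinearODE`). First of four
files (`…Jets`, `…Certificate`, `…StageSound`, `…Chain`) that make the classical «Taylor series method with certified
remainder» for `P₂(u) y″ + P₁(u) y′ + P₀(u) y = 0` with RATIONAL polynomial coefficients a certificate the Lean kernel
replays by `decide`: at each centre `c` the Taylor coefficients of `P₁/P₂`, `P₀/P₂` (division recursion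
[cite: Henrici1974, §1.2 eq. (1.2-2)]) and the jets of the two basis solutions (recursion `ordCoeff_succ` of
`OrdinaryPointSeries.lean` [cite: Hartman2002, Ch. IV §12 (12.12)]) are computed in EXACT rational arithmetic, a finite
jet inequality certifies a geometric coefficient bound up to (almost) the true radius (`norm_ordCoeff_le_of_jet`,
[cite: CoddingtonLevinson1955, Ch. 4 §3]), and the partial sum plus the geometric tail encloses `(y, y′)(c + h)`
(Weierstrass–Henrici continuation [cite: Henrici1974, §3.6 eqs. (3.6-10)–(3.6-13)]). For LINEAR equations this is
exponentially cheaper in the kernel than interval Taylor models of the autonomised system (no Lie-series blow-up, no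
wrapping): measured ≈ 3–5 s per centre at jet length 42 with 200-digit rationals.

This file: the computable layer and its identification with the analytic objects —
* `sumR` (structurally recursive sums), `toPolyR`/`coeff_toPolyR`/`evalQ`/`cast_evalQ` (coefficient lists as real
  polynomials), `taylorQ` with `toPolyR_taylorQ` (= `Polynomial.taylor`), `divCoeffs` with `cast_divCoeffs`
  (= `ratTaylorCoeff` of `RationalTaylorMajorant.lean`), `jets`/`jetNext` with `cast_jets` (= `ordCoeff`), `castPair`.

Written for cell certnum (RQ-012, LADDER-GRIDFUSION F3.r3: the wall-side outer solutions of the cylindrical tearing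
equation), free of instance data. No axioms beyond the standard three, no `sorry`.

## References
* P. Henrici, *Applied and Computational Complex Analysis*, Vol. 1, Wiley 1974: §1.2 (formal power series, the division
  recursion (1.2-2)), §2.3 Lemma 2.3f (majorant of the reciprocal), §3.6 (numerical analytic continuation along an arc,
  eqs. (3.6-10)–(3.6-13)). Key `Henrici1974`.
* E. A. Coddington, N. Levinson, *Theory of Ordinary Differential Equations*, McGraw–Hill 1955, Ch. 3 §8 (linear
  equations with analytic coefficients), Ch. 4 §3 (the majorant method). Key `CoddingtonLevinson1955`.
* P. Hartman, *Ordinary Differential Equations*, SIAM Classics 38 (2002), Ch. IV §1 Lemma 1.1 (uniqueness), §12 (12.12)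
  (undetermined coefficients). Key `Hartman2002`.
* R. E. Moore, *Interval Analysis*, Prentice–Hall 1966, §3.2 (rounded rational arithmetic). Key `Moore1966`.
-/

open Finset Polynomial Set
open Literature.Analysis.ODE

namespace Literature.Computation.Certificates

namespace LinearODE

/-! ### Kernel-friendly sums and coefficient lists -/

/-- `Σ_{k<n} f k` by structural recursion (kernel-friendly). [cite: Henrici1974, §1.2 eq. (1.2-2)] -/
def sumR {α : Type*} [Zero α] [Add α] (f : ℕ → α) : ℕ → α
  | 0 => 0
  | n + 1 => sumR f n + f n

/-- `sumR f n = Σ_{k<n} f k`. [cite: Henrici1974, §1.2 eq. (1.2-2)] -/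
theorem sumR_eq {α : Type*} [AddCommMonoid α] (f : ℕ → α) (n : ℕ) : sumR f n = ∑ k ∈ range n, f k := by
  induction n with
  | zero => simp [sumR]
  | succ n ih => rw [sumR, ih, Finset.sum_range_succ]

/-- The real polynomial with the given list of rational coefficients (index = degree).
[cite: Henrici1974, §1.2 eq. (1.2-2)] -/
noncomputable def toPolyR (l : List ℚ) : ℝ[X] := ∑ i ∈ range l.length, C ((l.getD i 0 : ℚ) : ℝ) * X ^ i

/-- Coefficients of `toPolyR`. [cite: Henrici1974, §1.2 eq. (1.2-2)] -/
theorem coeff_toPolyR (l : List ℚ) (n : ℕ) : (toPolyR l).coeff n = ((l.getD n 0 : ℚ) : ℝ) := by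
  rw [toPolyR, finsetSum_coeff]
  simp only [coeff_C_mul_X_pow]
  by_cases hn : n < l.length
  · rw [Finset.sum_eq_single n]
    · simp
    · intro i _ hi; simp [Ne.symm hi]
    · intro h; exact absurd (mem_range.2 hn) h
  · rw [Finset.sum_eq_zero]
    · rw [List.getD_eq_default _ _ (not_lt.1 hn)]; simp
    · intro i hi
      have : i ≠ n := fun h => hn (h ▸ mem_range.1 hi)
      simp [this.symm]

/-- `deg (toPolyR l) < |l|` (for a nonempty list) — more precisely `natDegree ≤ |l| − 1`.
[cite: Henrici1974, §1.2 eq. (1.2-2)] -/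
theorem natDegree_toPolyR_le (l : List ℚ) : (toPolyR l).natDegree ≤ l.length - 1 := by
  rw [natDegree_le_iff_coeff_eq_zero]
  intro n hn
  rw [coeff_toPolyR, List.getD_eq_default _ _ (by omega)]
  simp

/-- Horner-free evaluation of a coefficient list: `Σ l_i x^i`. [cite: Henrici1974, §1.2 eq. (1.2-2)] -/
def evalQ (l : List ℚ) (x : ℚ) : ℚ := sumR (fun i => l.getD i 0 * x ^ i) l.length

/-- `evalQ` is evaluation of `toPolyR`. [cite: Henrici1974, §1.2 eq. (1.2-2)] -/
theorem cast_evalQ (l : List ℚ) (x : ℚ) : ((evalQ l x : ℚ) : ℝ) = (toPolyR l).eval (x : ℝ) := by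
  rw [evalQ, sumR_eq, toPolyR, eval_finsetSum]
  push_cast
  refine Finset.sum_congr rfl fun i _ => ?_
  simp only [eval_mul, eval_C, eval_pow, eval_X]

/-! ### The Taylor shift at a rational centre -/

/-- Coefficient `j` of `p(c + x)`: `Σ_i C(i+j, j) p_{i+j} cⁱ`. [cite: Henrici1974, §3.6 eq. (3.6-10)] -/
def taylorCoeffQ (l : List ℚ) (c : ℚ) (j : ℕ) : ℚ :=
  sumR (fun i => ((i + j).choose j : ℚ) * l.getD (i + j) 0 * c ^ i) l.length

/-- The coefficient list of `p(c + x)` (same length as `p`). [cite: Henrici1974, §3.6 eq. (3.6-10)] -/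
def taylorQ (l : List ℚ) (c : ℚ) : List ℚ := (List.range l.length).map (taylorCoeffQ l c)

/-- Length of the shifted list. [cite: Henrici1974, §3.6 eq. (3.6-10)] -/
@[simp] theorem length_taylorQ (l : List ℚ) (c : ℚ) : (taylorQ l c).length = l.length := by
  simp [taylorQ]

/-- The computed shift IS Mathlib's `Polynomial.taylor`. [cite: Henrici1974, §3.6 eq. (3.6-10)] -/
theorem toPolyR_taylorQ (l : List ℚ) (c : ℚ) : toPolyR (taylorQ l c) = taylor (c : ℝ) (toPolyR l) := by
  rcases Nat.eq_zero_or_pos l.length with h0 | hpos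
  · have hl : l = [] := List.length_eq_zero_iff.1 h0
    subst hl
    simp [toPolyR, taylorQ]
  ext j
  have hdeg : (hasseDeriv j (toPolyR l)).natDegree < l.length :=
    lt_of_le_of_lt ((natDegree_hasseDeriv_le _ _).trans (Nat.sub_le _ _))
      (lt_of_le_of_lt (natDegree_toPolyR_le l) (by omega))
  rw [coeff_toPolyR, taylor_coeff, eval_eq_sum_range' hdeg]
  by_cases hj : j < l.length
  · rw [taylorQ, List.getD_eq_getElem _ _ (by simpa using hj)]
    simp only [List.getElem_map, List.getElem_range]
    rw [taylorCoeffQ, sumR_eq]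
    push_cast
    refine Finset.sum_congr rfl fun i _ => ?_
    rw [hasseDeriv_coeff, coeff_toPolyR]
  · rw [taylorQ, List.getD_eq_default _ _ (by simpa using hj)]
    push_cast
    symm
    refine Finset.sum_eq_zero fun i _ => ?_
    rw [hasseDeriv_coeff, coeff_toPolyR, List.getD_eq_default _ _ (by omega)]
    simp

/-! ### The division recursion (Taylor coefficients of a quotient) in exact arithmetic -/

/-- The list `[c₀, …, c_{m−1}]` of Taylor coefficients of `P/D` (`D₀ = 1`) by the division recursion
`c_n = P_n − Σ_{k<n} D_{n−k} c_k`. [cite: Henrici1974, §1.2 eq. (1.2-2)] -/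
def divCoeffs (P D : List ℚ) : ℕ → List ℚ
  | 0 => []
  | m + 1 =>
    let cs := divCoeffs P D m
    cs ++ [P.getD m 0 - sumR (fun k => D.getD (m - k) 0 * cs.getD k 0) m]

/-- Length of the coefficient list. [cite: Henrici1974, §1.2 eq. (1.2-2)] -/
@[simp] theorem length_divCoeffs (P D : List ℚ) (m : ℕ) : (divCoeffs P D m).length = m := by
  induction m with
  | zero => rfl
  | succ m ih => simp [divCoeffs, ih]

/-- The list is built by appending: earlier entries are unchanged. [cite: Henrici1974, §1.2 eq. (1.2-2)] -/
theorem divCoeffs_getD_succ (P D : List ℚ) {m n : ℕ} (h : n < m) :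
    (divCoeffs P D (m + 1)).getD n 0 = (divCoeffs P D m).getD n 0 := by
  show (divCoeffs P D m ++ [_]).getD n 0 = _
  rw [List.getD_append _ _ _ _ (by simpa using h)]

/-- Entries below `m` are stable under any number of further steps. [cite: Henrici1974, §1.2 eq. (1.2-2)] -/
theorem divCoeffs_getD_add (P D : List ℚ) {m n : ℕ} (h : n < m) :
    ∀ k : ℕ, (divCoeffs P D (m + k)).getD n 0 = (divCoeffs P D m).getD n 0
  | 0 => rfl
  | k + 1 => by
    rw [← add_assoc, divCoeffs_getD_succ P D (by omega), divCoeffs_getD_add P D h k]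

/-- **The computed coefficients are the Taylor coefficients of the quotient** (`ratTaylorCoeff` of
`RationalTaylorMajorant.lean`, cast to `ℝ`). [cite: Henrici1974, §1.2 eq. (1.2-2)] -/
theorem cast_divCoeffs (P D : List ℚ) {m n : ℕ} (h : n < m) :
    (((divCoeffs P D m).getD n 0 : ℚ) : ℝ) = ratTaylorCoeff (toPolyR P) (toPolyR D) n := by
  induction m generalizing n with
  | zero => exact absurd h (Nat.not_lt_zero n)
  | succ m ih =>
    rcases Nat.lt_succ_iff_lt_or_eq.1 h with hn | rfl
    · rw [divCoeffs_getD_succ P D hn]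
      exact ih hn
    · -- the new entry
      have e : (divCoeffs P D (n + 1)).getD n 0 =
          P.getD n 0 - sumR (fun k => D.getD (n - k) 0 * (divCoeffs P D n).getD k 0) n := by
        show (divCoeffs P D n ++ [_]).getD n 0 = _
        rw [List.getD_append_right _ _ _ _ (by simp)]
        simp
      rw [e, ratTaylorCoeff_eq, sumR_eq]
      push_cast
      rw [coeff_toPolyR]
      congr 1
      refine Finset.sum_congr rfl fun k hk => ?_
      rw [coeff_toPolyR, ih (mem_range.1 hk)]

/-! ### The jets of the two basis solutions by the closed recursion `ordCoeff_succ` -/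

/-- One step of the recursion: from `[v₀, …, v_n]` compute
`v_{n+1} = (1/(n+1)) ((v_n)₂, −Σ_{k≤n} (Q_k (v_{n−k})₁ + P_k (v_{n−k})₂))`.
[cite: Hartman2002, Ch. IV §12 (12.12)] -/
def jetNext (pt qt : List ℚ) (vs : List (ℚ × ℚ)) (n : ℕ) : ℚ × ℚ :=
  let s := sumR (fun k => qt.getD k 0 * (vs.getD (n - k) 0).1 + pt.getD k 0 * (vs.getD (n - k) 0).2) (n + 1)
  ((vs.getD n 0).2 / ((n : ℚ) + 1), -s / ((n : ℚ) + 1))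

/-- The jet `[v₀, …, v_m]` (length `m + 1`) through `v₀`. [cite: Hartman2002, Ch. IV §12 (12.12)] -/
def jets (pt qt : List ℚ) (v0 : ℚ × ℚ) : ℕ → List (ℚ × ℚ)
  | 0 => [v0]
  | m + 1 =>
    let vs := jets pt qt v0 m
    vs ++ [jetNext pt qt vs m]

/-- Length of the jet list. [cite: Hartman2002, Ch. IV §12 (12.12)] -/
@[simp] theorem length_jets (pt qt : List ℚ) (v0 : ℚ × ℚ) (m : ℕ) : (jets pt qt v0 m).length = m + 1 := by
  induction m with
  | zero => rfl
  | succ m ih => simp [jets, ih]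

/-- Earlier jet entries are unchanged by the next step. [cite: Hartman2002, Ch. IV §12 (12.12)] -/
theorem jets_getD_succ (pt qt : List ℚ) (v0 : ℚ × ℚ) {m n : ℕ} (h : n ≤ m) :
    (jets pt qt v0 (m + 1)).getD n 0 = (jets pt qt v0 m).getD n 0 := by
  show (jets pt qt v0 m ++ [_]).getD n 0 = _
  rw [List.getD_append _ _ _ _ (by simp; omega)]

/-- Entries up to `m` are stable under further steps. [cite: Hartman2002, Ch. IV §12 (12.12)] -/
theorem jets_getD_add (pt qt : List ℚ) (v0 : ℚ × ℚ) {m n : ℕ} (h : n ≤ m) :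
    ∀ k : ℕ, (jets pt qt v0 (m + k)).getD n 0 = (jets pt qt v0 m).getD n 0
  | 0 => rfl
  | k + 1 => by
    rw [← add_assoc, jets_getD_succ pt qt v0 (by omega), jets_getD_add pt qt v0 h k]

/-! ### Small list/cast helpers -/

/-- Coefficients of a list scaled entrywise. [cite: Henrici1974, §1.2 eq. (1.2-2)] -/
theorem getD_map_div (l : List ℚ) (d : ℚ) (i : ℕ) : (l.map (· / d)).getD i 0 = l.getD i 0 / d := by
  by_cases hi : i < l.length
  · rw [List.getD_eq_getElem _ _ (by simpa using hi), List.getElem_map, List.getD_eq_getElem _ _ hi]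
  · rw [List.getD_eq_default _ _ (by simpa using hi), List.getD_eq_default _ _ (not_lt.1 hi), zero_div]

/-- `toPolyR (l / d) = C d⁻¹ · toPolyR l`. [cite: Henrici1974, §1.2 eq. (1.2-2)] -/
theorem toPolyR_map_div (l : List ℚ) (d : ℚ) :
    toPolyR (l.map (· / d)) = C ((d : ℝ)⁻¹) * toPolyR l := by
  ext i
  rw [coeff_toPolyR, coeff_C_mul, coeff_toPolyR, getD_map_div]
  push_cast
  ring

/-- Casting a pair of rationals. [cite: Hartman2002, Ch. IV §12 (12.12)] -/
def castPair (v : ℚ × ℚ) : ℝ × ℝ := ((v.1 : ℝ), (v.2 : ℝ))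

/-- [cite: Hartman2002, Ch. IV §12 (12.12)] -/
@[simp] theorem castPair_fst (v : ℚ × ℚ) : (castPair v).1 = (v.1 : ℝ) := rfl
/-- [cite: Hartman2002, Ch. IV §12 (12.12)] -/
@[simp] theorem castPair_snd (v : ℚ × ℚ) : (castPair v).2 = (v.2 : ℝ) := rfl

/-- The sup norm of a cast pair is the cast of `max |v₁| |v₂|`. [cite: Hartman2002, Ch. IV §12 (12.12)] -/
theorem norm_castPair (v : ℚ × ℚ) : ‖castPair v‖ = ((max |v.1| |v.2| : ℚ) : ℝ) := by
  rw [castPair, Prod.norm_mk, Real.norm_eq_abs, Real.norm_eq_abs]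
  push_cast
  rfl

/-! ### The computed jets are the Taylor coefficients `ordCoeff` -/

/-- **The computed jet is the Frobenius/Taylor jet** `ordCoeff` of `OrdinaryPointSeries.lean` (cast to `ℝ`), as long as
the coefficient lists agree with the coefficient sequences on the indices used. [cite: Hartman2002, Ch. IV §12 (12.12)] -/
theorem cast_jets {pt qt : List ℚ} {ptR qtR : ℕ → ℝ} (y₀ y₁ : ℚ) :
    ∀ (m : ℕ), (∀ k < m, ((pt.getD k 0 : ℚ) : ℝ) = ptR k) → (∀ k < m, ((qt.getD k 0 : ℚ) : ℝ) = qtR k) →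
      ∀ n ≤ m, castPair ((jets pt qt (y₀, y₁) m).getD n 0) = ordCoeff ptR qtR (y₀ : ℝ) (y₁ : ℝ) n
  | 0, _, _, n, hn => by
    obtain rfl : n = 0 := Nat.le_zero.1 hn
    simp [jets, castPair]
  | m + 1, hp, hq, n, hn => by
    have ih := cast_jets y₀ y₁ m (fun k hk => hp k (by omega)) (fun k hk => hq k (by omega))
    rcases Nat.lt_succ_iff_lt_or_eq.1 (Nat.lt_succ_iff.2 hn) with hlt | rfl
    · rw [jets_getD_succ pt qt (y₀, y₁) (Nat.lt_succ_iff.1 hlt)]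
      exact ih n (Nat.lt_succ_iff.1 hlt)
    · -- the new entry `v_{m+1}`
      have e : (jets pt qt (y₀, y₁) (m + 1)).getD (m + 1) 0 = jetNext pt qt (jets pt qt (y₀, y₁) m) m := by
        show (jets pt qt (y₀, y₁) m ++ [_]).getD (m + 1) 0 = _
        rw [List.getD_append_right _ _ _ _ (by simp)]
        simp
      rw [e]
      have hrec := ordCoeff_succ ptR qtR (y₀ : ℝ) (y₁ : ℝ) m
      have hm0 : ((m : ℝ) + 1) ≠ 0 := by positivity
      have key : ordCoeff ptR qtR (y₀ : ℝ) (y₁ : ℝ) (m + 1) =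
          ((m : ℝ) + 1)⁻¹ • (((m : ℝ) + 1) • ordCoeff ptR qtR (y₀ : ℝ) (y₁ : ℝ) (m + 1)) := by
        rw [smul_smul, inv_mul_cancel₀ hm0, one_smul]
      rw [key, hrec]
      -- identify the sum
      have hs : ∀ k ∈ range (m + 1),
          ((qt.getD k 0 : ℚ) : ℝ) * ((((jets pt qt (y₀, y₁) m).getD (m - k) 0).1 : ℚ) : ℝ) +
              ((pt.getD k 0 : ℚ) : ℝ) * ((((jets pt qt (y₀, y₁) m).getD (m - k) 0).2 : ℚ) : ℝ) =
            qtR k * (ordCoeff ptR qtR (y₀ : ℝ) (y₁ : ℝ) (m - k)).1 +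
              ptR k * (ordCoeff ptR qtR (y₀ : ℝ) (y₁ : ℝ) (m - k)).2 := by
        intro k hk
        have hk' := mem_range.1 hk
        have hv := ih (m - k) (Nat.sub_le m k)
        rw [← hv, ← hp k hk', ← hq k hk', castPair_fst, castPair_snd]
      have hvm := ih m le_rfl
      ext
      · rw [castPair_fst, Prod.smul_fst, smul_eq_mul, jetNext, ← hvm, castPair_snd]
        push_cast
        ring
      · rw [castPair_snd, Prod.smul_snd, smul_eq_mul, jetNext, sumR_eq]
        push_cast
        rw [Finset.sum_congr rfl hs]
        ring

end LinearODE

end Literature.Computation.Certificates
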